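import Mathlib
import HarnessLib
import Literature.Combinatorics.Optimization.LowAutocorrelation

/-!
# LABS: kernel-certified witness upper bounds `labsMin N ≤ E` for `8 ≤ N ≤ 45`

Companion to `Literature.Combinatorics.Optimization.LowAutocorrelation` (the typed LABS objective and the
`decide`-certified optima for `3 ≤ N ≤ 7`). For each `8 ≤ N ≤ 45` this file records ONE explicit sequence
`s : Fin N → Bool` together with the kernel-checked value of `LABS.energy s` (tactic `decide`, no
`native_decide`; `maxRecDepth` raised for the larger sums), giving `LABS.labsMin N ≤ E(N)` by
`LABS.labsMin_le_energy`. The right-hand sides `E(N)` are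

  8, 12, 13, 5, 10, 6, 19, 15, 24, 32, 25, 29, 26, 26, 39, 47, 36, 36, 45, 37, 50, 62, 59, 67, 64, 64, 65,
  73, 82, 86, 87, 99, 108, 108, 101, 109, 122, 118   (N = 8, …, 45),

which coincide with the OPTIMAL energies tabulated in Packebusch–Mertens [PackebuschMertens2016, Table 1]
(exhaustive branch and bound; optimal `E` known for all `N ≤ 66`). Optimality (the matching lower bounds)
is NOT asserted here: it needs an exhaustive search that is out of reach of `decide`; in the `pub-qadeq`
lane it is certified outside Lean by two independent enumerations (files under the lane's `certs/`).
The witnesses were produced by the lane's memetic tabu search solvers (time-to-solution experiments on the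
claims of Shaydulin et al., arXiv:2308.02342) and each energy was re-verified by two further independent
implementations before being typed here. No named facts, no axioms beyond the three standard ones.

Witness table (`+` = `true` = spin `+1`, `-` = `false` = spin `−1`):
  `N =  8`: `E ≤   8`  (`-+-++---`)
  `N =  9`: `E ≤  12`  (`----++-+-`)
  `N = 10`: `E ≤  13`  (`+-++-+++--`)
  `N = 11`: `E ≤   5`  (`---+++-++-+`)
  `N = 12`: `E ≤  10`  (`-----++--+-+`)
  `N = 13`: `E ≤   6`  (`+++++--++-+-+`)
  `N = 14`: `E ≤  19`  (`++--++-+-+++++`)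
  `N = 15`: `E ≤  15`  (`-----++--++-+-+`)
  `N = 16`: `E ≤  24`  (`---+---+++-+--+-`)
  `N = 17`: `E ≤  32`  (`++-+--+-+++-+++--`)
  `N = 18`: `E ≤  25`  (`-++--+----++++-+-+`)
  `N = 19`: `E ≤  29`  (`+---++--+-++++++-+-`)
  `N = 20`: `E ≤  26`  (`-++---++-+---+-+++++`)
  `N = 21`: `E ≤  26`  (`--+++++++--++-+-+-++-`)
  `N = 22`: `E ≤  39`  (`+--+--++---+++++++-+-+`)
  `N = 23`: `E ≤  47`  (`++---+-+++-+--+----+---`)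
  `N = 24`: `E ≤  36`  (`+--+--+-+-+------+++--++`)
  `N = 25`: `E ≤  36`  (`-+--+--+-+-+------+++--++`)
  `N = 26`: `E ≤  45`  (`+-+-+--+--++-+++++++---+++`)
  `N = 27`: `E ≤  37`  (`+-++-+--+---+---+---++++---`)
  `N = 28`: `E ≤  50`  (`-+++----+++-+++-+++-++-+--+-`)
  `N = 29`: `E ≤  62`  (`---++---+++++++-+-+-++-++--+-`)
  `N = 30`: `E ≤  59`  (`+-+-++-+-+++---+++++++-++--+--`)
  `N = 31`: `E ≤  67`  (`-+-++-+-+--++-++--+++---+++++++`)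
  `N = 32`: `E ≤  64`  (`-++--+--++---+++-+-+--+-+-------`)
  `N = 33`: `E ≤  64`  (`-++--++--+-+-+-+--+-++----+++++++`)
  `N = 34`: `E ≤  65`  (`--++--++---------++++--+-++-+-+-+-`)
  `N = 35`: `E ≤  73`  (`-------+--++-++--+-+-++-+-+---+++--`)
  `N = 36`: `E ≤  82`  (`+-++-+-++-++-+++-+-+++--+++------+++`)
  `N = 37`: `E ≤  86`  (`+--++--++-+-+-+--+-++----++++--------`)
  `N = 38`: `E ≤  87`  (`++++++++----++++--+-++-+-+-+-++--++--+`)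
  `N = 39`: `E ≤  99`  (`-+-+-+-++---++++---++-++-+--+--++++++++`)
  `N = 40`: `E ≤ 108`  (`++++----++++-++-+--+---+-++-+++-+++-+++-`)
  `N = 41`: `E ≤ 108`  (`+++----+++-+-+-+--++--++--------+--+-++-+`)
  `N = 42`: `E ≤ 101`  (`++-+--+-++-+---++++---+----+++-+++-+++-+++`)
  `N = 43`: `E ≤ 109`  (`+++-++--+-++-++-------+-+-+--+++----++---+-`)
  `N = 44`: `E ≤ 122`  (`--+++++-----++--+++++-++++-+++-++-+-++--+-+-`)
  `N = 45`: `E ≤ 118`  (`--------++-++-+--+--+++-++---++++---++-+-+-+-`)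

## References
* [PackebuschMertens2016] T. Packebusch, S. Mertens, J. Phys. A 49 (2016) 165001 (arXiv:1512.02475),
  Table 1 (optimal energies for `N ≤ 66`).
-/

namespace Literature.Combinatorics.Optimization

namespace LABS

/-- `E_min(8) ≤ 8`, by the explicit witness `-+-++---` whose energy `decide` evaluates to `8`;
`8` is the optimal value tabulated in [cite: PackebuschMertens2016, Table 1] (optimality not asserted here). -/
theorem labsMin_le_8 : labsMin 8 ≤ 8 :=
  le_of_le_of_eq (labsMin_le_energy (N := 8) ![false, true, false, true, true, false, false, false])
    (by set_option maxRecDepth 200000 in set_option maxHeartbeats 400000000 in decide)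

/-- `E_min(9) ≤ 12`, by the explicit witness `----++-+-` whose energy `decide` evaluates to `12`;
`12` is the optimal value tabulated in [cite: PackebuschMertens2016, Table 1] (optimality not asserted here). -/
theorem labsMin_le_9 : labsMin 9 ≤ 12 :=
  le_of_le_of_eq (labsMin_le_energy (N := 9) ![false, false, false, false, true, true, false, true, false])
    (by set_option maxRecDepth 200000 in set_option maxHeartbeats 400000000 in decide)

/-- `E_min(10) ≤ 13`, by the explicit witness `+-++-+++--` whose energy `decide` evaluates to `13`;
`13` is the optimal value tabulated in [cite: PackebuschMertens2016, Table 1] (optimality not asserted here). -/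
theorem labsMin_le_10 : labsMin 10 ≤ 13 :=
  le_of_le_of_eq (labsMin_le_energy (N := 10) ![true, false, true, true, false, true, true, true, false, false])
    (by set_option maxRecDepth 200000 in set_option maxHeartbeats 400000000 in decide)

/-- `E_min(11) ≤ 5`, by the explicit witness `---+++-++-+` whose energy `decide` evaluates to `5`;
`5` is the optimal value tabulated in [cite: PackebuschMertens2016, Table 1] (optimality not asserted here). -/
theorem labsMin_le_11 : labsMin 11 ≤ 5 :=
  le_of_le_of_eq (labsMin_le_energy (N := 11) ![false, false, false, true, true, true, false, true, true, false, true])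
    (by set_option maxRecDepth 200000 in set_option maxHeartbeats 400000000 in decide)

/-- `E_min(12) ≤ 10`, by the explicit witness `-----++--+-+` whose energy `decide` evaluates to `10`;
`10` is the optimal value tabulated in [cite: PackebuschMertens2016, Table 1] (optimality not asserted here). -/
theorem labsMin_le_12 : labsMin 12 ≤ 10 :=
  le_of_le_of_eq (labsMin_le_energy (N := 12) ![false, false, false, false, false, true, true, false, false, true, false, true])
    (by set_option maxRecDepth 200000 in set_option maxHeartbeats 400000000 in decide)

/-- `E_min(13) ≤ 6`, by the explicit witness `+++++--++-+-+` whose energy `decide` evaluates to `6`;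
`6` is the optimal value tabulated in [cite: PackebuschMertens2016, Table 1] (optimality not asserted here). -/
theorem labsMin_le_13 : labsMin 13 ≤ 6 :=
  le_of_le_of_eq (labsMin_le_energy (N := 13) ![true, true, true, true, true, false, false, true, true, false, true, false, true])
    (by set_option maxRecDepth 200000 in set_option maxHeartbeats 400000000 in decide)

/-- `E_min(14) ≤ 19`, by the explicit witness `++--++-+-+++++` whose energy `decide` evaluates to `19`;
`19` is the optimal value tabulated in [cite: PackebuschMertens2016, Table 1] (optimality not asserted here). -/
theorem labsMin_le_14 : labsMin 14 ≤ 19 :=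
  le_of_le_of_eq (labsMin_le_energy (N := 14) ![true, true, false, false, true, true, false, true, false, true, true, true, true, true])
    (by set_option maxRecDepth 200000 in set_option maxHeartbeats 400000000 in decide)

/-- `E_min(15) ≤ 15`, by the explicit witness `-----++--++-+-+` whose energy `decide` evaluates to `15`;
`15` is the optimal value tabulated in [cite: PackebuschMertens2016, Table 1] (optimality not asserted here). -/
theorem labsMin_le_15 : labsMin 15 ≤ 15 :=
  le_of_le_of_eq (labsMin_le_energy (N := 15) ![false, false, false, false, false, true, true, false, false, true, true, false, true, false, true])
    (by set_option maxRecDepth 200000 in set_option maxHeartbeats 400000000 in decide)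

/-- `E_min(16) ≤ 24`, by the explicit witness `---+---+++-+--+-` whose energy `decide` evaluates to `24`;
`24` is the optimal value tabulated in [cite: PackebuschMertens2016, Table 1] (optimality not asserted here). -/
theorem labsMin_le_16 : labsMin 16 ≤ 24 :=
  le_of_le_of_eq (labsMin_le_energy (N := 16) ![false, false, false, true, false, false, false, true, true, true, false, true, false, false, true, false])
    (by set_option maxRecDepth 200000 in set_option maxHeartbeats 400000000 in decide)

/-- `E_min(17) ≤ 32`, by the explicit witness `++-+--+-+++-+++--` whose energy `decide` evaluates to `32`;
`32` is the optimal value tabulated in [cite: PackebuschMertens2016, Table 1] (optimality not asserted here). -/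
theorem labsMin_le_17 : labsMin 17 ≤ 32 :=
  le_of_le_of_eq (labsMin_le_energy (N := 17) ![true, true, false, true, false, false, true, false, true, true, true, false, true, true, true, false, false])
    (by set_option maxRecDepth 200000 in set_option maxHeartbeats 400000000 in decide)

/-- `E_min(18) ≤ 25`, by the explicit witness `-++--+----++++-+-+` whose energy `decide` evaluates to `25`;
`25` is the optimal value tabulated in [cite: PackebuschMertens2016, Table 1] (optimality not asserted here). -/
theorem labsMin_le_18 : labsMin 18 ≤ 25 :=
  le_of_le_of_eq (labsMin_le_energy (N := 18) ![false, true, true, false, false, true, false, false, false, false, true, true, true, true, false, true, false, true])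
    (by set_option maxRecDepth 200000 in set_option maxHeartbeats 400000000 in decide)

/-- `E_min(19) ≤ 29`, by the explicit witness `+---++--+-++++++-+-` whose energy `decide` evaluates to `29`;
`29` is the optimal value tabulated in [cite: PackebuschMertens2016, Table 1] (optimality not asserted here). -/
theorem labsMin_le_19 : labsMin 19 ≤ 29 :=
  le_of_le_of_eq (labsMin_le_energy (N := 19) ![true, false, false, false, true, true, false, false, true, false, true, true, true, true, true, true, false, true, false])
    (by set_option maxRecDepth 200000 in set_option maxHeartbeats 400000000 in decide)

/-- `E_min(20) ≤ 26`, by the explicit witness `-++---++-+---+-+++++` whose energy `decide` evaluates to `26`;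
`26` is the optimal value tabulated in [cite: PackebuschMertens2016, Table 1] (optimality not asserted here). -/
theorem labsMin_le_20 : labsMin 20 ≤ 26 :=
  le_of_le_of_eq (labsMin_le_energy (N := 20) ![false, true, true, false, false, false, true, true, false, true, false, false, false, true, false, true, true, true, true, true])
    (by set_option maxRecDepth 200000 in set_option maxHeartbeats 400000000 in decide)

/-- `E_min(21) ≤ 26`, by the explicit witness `--+++++++--++-+-+-++-` whose energy `decide` evaluates to `26`;
`26` is the optimal value tabulated in [cite: PackebuschMertens2016, Table 1] (optimality not asserted here). -/
theorem labsMin_le_21 : labsMin 21 ≤ 26 :=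
  le_of_le_of_eq (labsMin_le_energy (N := 21) ![false, false, true, true, true, true, true, true, true, false, false, true, true, false, true, false, true, false, true, true, false])
    (by set_option maxRecDepth 200000 in set_option maxHeartbeats 400000000 in decide)

/-- `E_min(22) ≤ 39`, by the explicit witness `+--+--++---+++++++-+-+` whose energy `decide` evaluates to `39`;
`39` is the optimal value tabulated in [cite: PackebuschMertens2016, Table 1] (optimality not asserted here). -/
theorem labsMin_le_22 : labsMin 22 ≤ 39 :=
  le_of_le_of_eq (labsMin_le_energy (N := 22) ![true, false, false, true, false, false, true, true, false, false, false, true, true, true, true, true, true, true, false, true, false, true])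
    (by set_option maxRecDepth 200000 in set_option maxHeartbeats 400000000 in decide)

/-- `E_min(23) ≤ 47`, by the explicit witness `++---+-+++-+--+----+---` whose energy `decide` evaluates to `47`;
`47` is the optimal value tabulated in [cite: PackebuschMertens2016, Table 1] (optimality not asserted here). -/
theorem labsMin_le_23 : labsMin 23 ≤ 47 :=
  le_of_le_of_eq (labsMin_le_energy (N := 23) ![true, true, false, false, false, true, false, true, true, true, false, true, false, false, true, false, false, false, false, true, false, false, false])
    (by set_option maxRecDepth 200000 in set_option maxHeartbeats 400000000 in decide)

/-- `E_min(24) ≤ 36`, by the explicit witness `+--+--+-+-+------+++--++` whose energy `decide` evaluates to `36`;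
`36` is the optimal value tabulated in [cite: PackebuschMertens2016, Table 1] (optimality not asserted here). -/
theorem labsMin_le_24 : labsMin 24 ≤ 36 :=
  le_of_le_of_eq (labsMin_le_energy (N := 24) ![true, false, false, true, false, false, true, false, true, false, true, false, false, false, false, false, false, true, true, true, false, false, true, true])
    (by set_option maxRecDepth 200000 in set_option maxHeartbeats 400000000 in decide)

/-- `E_min(25) ≤ 36`, by the explicit witness `-+--+--+-+-+------+++--++` whose energy `decide` evaluates to `36`;
`36` is the optimal value tabulated in [cite: PackebuschMertens2016, Table 1] (optimality not asserted here). -/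
theorem labsMin_le_25 : labsMin 25 ≤ 36 :=
  le_of_le_of_eq (labsMin_le_energy (N := 25) ![false, true, false, false, true, false, false, true, false, true, false, true, false, false, false, false, false, false, true, true, true, false, false, true, true])
    (by set_option maxRecDepth 200000 in set_option maxHeartbeats 400000000 in decide)

/-- `E_min(26) ≤ 45`, by the explicit witness `+-+-+--+--++-+++++++---+++` whose energy `decide` evaluates to `45`;
`45` is the optimal value tabulated in [cite: PackebuschMertens2016, Table 1] (optimality not asserted here). -/
theorem labsMin_le_26 : labsMin 26 ≤ 45 :=
  le_of_le_of_eq (labsMin_le_energy (N := 26) ![true, false, true, false, true, false, false, true, false, false, true, true, false, true, true, true, true, true, true, true, false, false, false, true, true, true])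
    (by set_option maxRecDepth 200000 in set_option maxHeartbeats 400000000 in decide)

/-- `E_min(27) ≤ 37`, by the explicit witness `+-++-+--+---+---+---++++---` whose energy `decide` evaluates to `37`;
`37` is the optimal value tabulated in [cite: PackebuschMertens2016, Table 1] (optimality not asserted here). -/
theorem labsMin_le_27 : labsMin 27 ≤ 37 :=
  le_of_le_of_eq (labsMin_le_energy (N := 27) ![true, false, true, true, false, true, false, false, true, false, false, false, true, false, false, false, true, false, false, false, true, true, true, true, false, false, false])
    (by set_option maxRecDepth 200000 in set_option maxHeartbeats 400000000 in decide)

/-- `E_min(28) ≤ 50`, by the explicit witness `-+++----+++-+++-+++-++-+--+-` whose energy `decide` evaluates to `50`;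
`50` is the optimal value tabulated in [cite: PackebuschMertens2016, Table 1] (optimality not asserted here). -/
theorem labsMin_le_28 : labsMin 28 ≤ 50 :=
  le_of_le_of_eq (labsMin_le_energy (N := 28) ![false, true, true, true, false, false, false, false, true, true, true, false, true, true, true, false, true, true, true, false, true, true, false, true, false, false, true, false])
    (by set_option maxRecDepth 200000 in set_option maxHeartbeats 400000000 in decide)

/-- `E_min(29) ≤ 62`, by the explicit witness `---++---+++++++-+-+-++-++--+-` whose energy `decide` evaluates to `62`;
`62` is the optimal value tabulated in [cite: PackebuschMertens2016, Table 1] (optimality not asserted here). -/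
theorem labsMin_le_29 : labsMin 29 ≤ 62 :=
  le_of_le_of_eq (labsMin_le_energy (N := 29) ![false, false, false, true, true, false, false, false, true, true, true, true, true, true, true, false, true, false, true, false, true, true, false, true, true, false, false, true, false])
    (by set_option maxRecDepth 200000 in set_option maxHeartbeats 400000000 in decide)

/-- `E_min(30) ≤ 59`, by the explicit witness `+-+-++-+-+++---+++++++-++--+--` whose energy `decide` evaluates to `59`;
`59` is the optimal value tabulated in [cite: PackebuschMertens2016, Table 1] (optimality not asserted here). -/
theorem labsMin_le_30 : labsMin 30 ≤ 59 :=
  le_of_le_of_eq (labsMin_le_energy (N := 30) ![true, false, true, false, true, true, false, true, false, true, true, true, false, false, false, true, true, true, true, true, true, true, false, true, true, false, false, true, false, false])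
    (by set_option maxRecDepth 200000 in set_option maxHeartbeats 400000000 in decide)

/-- `E_min(31) ≤ 67`, by the explicit witness `-+-++-+-+--++-++--+++---+++++++` whose energy `decide` evaluates to `67`;
`67` is the optimal value tabulated in [cite: PackebuschMertens2016, Table 1] (optimality not asserted here). -/
theorem labsMin_le_31 : labsMin 31 ≤ 67 :=
  le_of_le_of_eq (labsMin_le_energy (N := 31) ![false, true, false, true, true, false, true, false, true, false, false, true, true, false, true, true, false, false, true, true, true, false, false, false, true, true, true, true, true, true, true])
    (by set_option maxRecDepth 200000 in set_option maxHeartbeats 400000000 in decide)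

/-- `E_min(32) ≤ 64`, by the explicit witness `-++--+--++---+++-+-+--+-+-------` whose energy `decide` evaluates to `64`;
`64` is the optimal value tabulated in [cite: PackebuschMertens2016, Table 1] (optimality not asserted here). -/
theorem labsMin_le_32 : labsMin 32 ≤ 64 :=
  le_of_le_of_eq (labsMin_le_energy (N := 32) ![false, true, true, false, false, true, false, false, true, true, false, false, false, true, true, true, false, true, false, true, false, false, true, false, true, false, false, false, false, false, false, false])
    (by set_option maxRecDepth 200000 in set_option maxHeartbeats 400000000 in decide)

/-- `E_min(33) ≤ 64`, by the explicit witness `-++--++--+-+-+-+--+-++----+++++++` whose energy `decide` evaluates to `64`;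
`64` is the optimal value tabulated in [cite: PackebuschMertens2016, Table 1] (optimality not asserted here). -/
theorem labsMin_le_33 : labsMin 33 ≤ 64 :=
  le_of_le_of_eq (labsMin_le_energy (N := 33) ![false, true, true, false, false, true, true, false, false, true, false, true, false, true, false, true, false, false, true, false, true, true, false, false, false, false, true, true, true, true, true, true, true])
    (by set_option maxRecDepth 200000 in set_option maxHeartbeats 400000000 in decide)

/-- `E_min(34) ≤ 65`, by the explicit witness `--++--++---------++++--+-++-+-+-+-` whose energy `decide` evaluates to `65`;
`65` is the optimal value tabulated in [cite: PackebuschMertens2016, Table 1] (optimality not asserted here). -/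
theorem labsMin_le_34 : labsMin 34 ≤ 65 :=
  le_of_le_of_eq (labsMin_le_energy (N := 34) ![false, false, true, true, false, false, true, true, false, false, false, false, false, false, false, false, false, true, true, true, true, false, false, true, false, true, true, false, true, false, true, false, true, false])
    (by set_option maxRecDepth 200000 in set_option maxHeartbeats 400000000 in decide)

/-- `E_min(35) ≤ 73`, by the explicit witness `-------+--++-++--+-+-++-+-+---+++--` whose energy `decide` evaluates to `73`;
`73` is the optimal value tabulated in [cite: PackebuschMertens2016, Table 1] (optimality not asserted here). -/
theorem labsMin_le_35 : labsMin 35 ≤ 73 :=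
  le_of_le_of_eq (labsMin_le_energy (N := 35) ![false, false, false, false, false, false, false, true, false, false, true, true, false, true, true, false, false, true, false, true, false, true, true, false, true, false, true, false, false, false, true, true, true, false, false])
    (by set_option maxRecDepth 200000 in set_option maxHeartbeats 400000000 in decide)

/-- `E_min(36) ≤ 82`, by the explicit witness `+-++-+-++-++-+++-+-+++--+++------+++` whose energy `decide` evaluates to `82`;
`82` is the optimal value tabulated in [cite: PackebuschMertens2016, Table 1] (optimality not asserted here). -/
theorem labsMin_le_36 : labsMin 36 ≤ 82 :=
  le_of_le_of_eq (labsMin_le_energy (N := 36) ![true, false, true, true, false, true, false, true, true, false, true, true, false, true, true, true, false, true, false, true, true, true, false, false, true, true, true, false, false, false, false, false, false, true, true, true])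
    (by set_option maxRecDepth 200000 in set_option maxHeartbeats 400000000 in decide)

/-- `E_min(37) ≤ 86`, by the explicit witness `+--++--++-+-+-+--+-++----++++--------` whose energy `decide` evaluates to `86`;
`86` is the optimal value tabulated in [cite: PackebuschMertens2016, Table 1] (optimality not asserted here). -/
theorem labsMin_le_37 : labsMin 37 ≤ 86 :=
  le_of_le_of_eq (labsMin_le_energy (N := 37) ![true, false, false, true, true, false, false, true, true, false, true, false, true, false, true, false, false, true, false, true, true, false, false, false, false, true, true, true, true, false, false, false, false, false, false, false, false])
    (by set_option maxRecDepth 200000 in set_option maxHeartbeats 400000000 in decide)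

/-- `E_min(38) ≤ 87`, by the explicit witness `++++++++----++++--+-++-+-+-+-++--++--+` whose energy `decide` evaluates to `87`;
`87` is the optimal value tabulated in [cite: PackebuschMertens2016, Table 1] (optimality not asserted here). -/
theorem labsMin_le_38 : labsMin 38 ≤ 87 :=
  le_of_le_of_eq (labsMin_le_energy (N := 38) ![true, true, true, true, true, true, true, true, false, false, false, false, true, true, true, true, false, false, true, false, true, true, false, true, false, true, false, true, false, true, true, false, false, true, true, false, false, true])
    (by set_option maxRecDepth 200000 in set_option maxHeartbeats 400000000 in decide)

/-- `E_min(39) ≤ 99`, by the explicit witness `-+-+-+-++---++++---++-++-+--+--++++++++` whose energy `decide` evaluates to `99`;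
`99` is the optimal value tabulated in [cite: PackebuschMertens2016, Table 1] (optimality not asserted here). -/
theorem labsMin_le_39 : labsMin 39 ≤ 99 :=
  le_of_le_of_eq (labsMin_le_energy (N := 39) ![false, true, false, true, false, true, false, true, true, false, false, false, true, true, true, true, false, false, false, true, true, false, true, true, false, true, false, false, true, false, false, true, true, true, true, true, true, true, true])
    (by set_option maxRecDepth 200000 in set_option maxHeartbeats 400000000 in decide)

/-- `E_min(40) ≤ 108`, by the explicit witness `++++----++++-++-+--+---+-++-+++-+++-+++-` whose energy `decide` evaluates to `108`;
`108` is the optimal value tabulated in [cite: PackebuschMertens2016, Table 1] (optimality not asserted here). -/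
theorem labsMin_le_40 : labsMin 40 ≤ 108 :=
  le_of_le_of_eq (labsMin_le_energy (N := 40) ![true, true, true, true, false, false, false, false, true, true, true, true, false, true, true, false, true, false, false, true, false, false, false, true, false, true, true, false, true, true, true, false, true, true, true, false, true, true, true, false])
    (by set_option maxRecDepth 200000 in set_option maxHeartbeats 400000000 in decide)

/-- `E_min(41) ≤ 108`, by the explicit witness `+++----+++-+-+-+--++--++--------+--+-++-+` whose energy `decide` evaluates to `108`;
`108` is the optimal value tabulated in [cite: PackebuschMertens2016, Table 1] (optimality not asserted here). -/
theorem labsMin_le_41 : labsMin 41 ≤ 108 :=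
  le_of_le_of_eq (labsMin_le_energy (N := 41) ![true, true, true, false, false, false, false, true, true, true, false, true, false, true, false, true, false, false, true, true, false, false, true, true, false, false, false, false, false, false, false, false, true, false, false, true, false, true, true, false, true])
    (by set_option maxRecDepth 200000 in set_option maxHeartbeats 400000000 in decide)

/-- `E_min(42) ≤ 101`, by the explicit witness `++-+--+-++-+---++++---+----+++-+++-+++-+++` whose energy `decide` evaluates to `101`;
`101` is the optimal value tabulated in [cite: PackebuschMertens2016, Table 1] (optimality not asserted here). -/
theorem labsMin_le_42 : labsMin 42 ≤ 101 :=
  le_of_le_of_eq (labsMin_le_energy (N := 42) ![true, true, false, true, false, false, true, false, true, true, false, true, false, false, false, true, true, true, true, false, false, false, true, false, false, false, false, true, true, true, false, true, true, true, false, true, true, true, false, true, true, true])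
    (by set_option maxRecDepth 200000 in set_option maxHeartbeats 400000000 in decide)

/-- `E_min(43) ≤ 109`, by the explicit witness `+++-++--+-++-++-------+-+-+--+++----++---+-` whose energy `decide` evaluates to `109`;
`109` is the optimal value tabulated in [cite: PackebuschMertens2016, Table 1] (optimality not asserted here). -/
theorem labsMin_le_43 : labsMin 43 ≤ 109 :=
  le_of_le_of_eq (labsMin_le_energy (N := 43) ![true, true, true, false, true, true, false, false, true, false, true, true, false, true, true, false, false, false, false, false, false, false, true, false, true, false, true, false, false, true, true, true, false, false, false, false, true, true, false, false, false, true, false])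
    (by set_option maxRecDepth 200000 in set_option maxHeartbeats 400000000 in decide)

/-- `E_min(44) ≤ 122`, by the explicit witness `--+++++-----++--+++++-++++-+++-++-+-++--+-+-` whose energy `decide` evaluates to `122`;
`122` is the optimal value tabulated in [cite: PackebuschMertens2016, Table 1] (optimality not asserted here). -/
theorem labsMin_le_44 : labsMin 44 ≤ 122 :=
  le_of_le_of_eq (labsMin_le_energy (N := 44) ![false, false, true, true, true, true, true, false, false, false, false, false, true, true, false, false, true, true, true, true, true, false, true, true, true, true, false, true, true, true, false, true, true, false, true, false, true, true, false, false, true, false, true, false])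
    (by set_option maxRecDepth 200000 in set_option maxHeartbeats 400000000 in decide)

/-- `E_min(45) ≤ 118`, by the explicit witness `--------++-++-+--+--+++-++---++++---++-+-+-+-` whose energy `decide` evaluates to `118`;
`118` is the optimal value tabulated in [cite: PackebuschMertens2016, Table 1] (optimality not asserted here). -/
theorem labsMin_le_45 : labsMin 45 ≤ 118 :=
  le_of_le_of_eq (labsMin_le_energy (N := 45) ![false, false, false, false, false, false, false, false, true, true, false, true, true, false, true, false, false, true, false, false, true, true, true, false, true, true, false, false, false, true, true, true, true, false, false, false, true, true, false, true, false, true, false, true, false])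
    (by set_option maxRecDepth 200000 in set_option maxHeartbeats 400000000 in decide)

end LABS

end Literature.Combinatorics.Optimization
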